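import Summits.SmoothPoincare4.SmoothPoincare4.Theorems.SullivanDualWitnessChargeDefs
import Summits.SmoothPoincare4.SmoothPoincare4.Theorems.SullivanDualWitnessChargeHelperAcsExtend
import Summits.SmoothPoincare4.SmoothPoincare4.Theorems.SullivanDualWitnessChargeHelperInTangentCoordinatesContMDiffOn
import Summits.SmoothPoincare4.SmoothPoincare4.Theorems.SullivanDualWitnessChargeHelperChartJ
import Summits.SmoothPoincare4.SmoothPoincare4.Theorems.SullivanDualWitnessChargeHelperJHolomorphicChart
import Summits.SmoothPoincare4.SmoothPoincare4.Theorems.SullivanDualWitnessChargeHelperUniformLimitLocalise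
import Literature.Geometry.Symplectic.JHolomorphicWeierstrass
import Literature.Geometry.Manifold.OpenSubmanifoldTangent
import Mathlib.Geometry.Manifold.MFDeriv.Tangent
import Mathlib.Topology.UniformSpace.UniformConvergence

/-!
# Helper `helper_rescaleLocal` of line `Sketch` (pencil-incompleteness) for crux `WitnessCharge`
(item stmt-SmoothPoincare4-7824; route `SullivanDual`, crux
`Summit.SmoothPoincare4.SmoothPoincare4.Theses.SullivanDual.WitnessCharge`; line `Sketch`,
stub `helper_rescaleLocal` — frontier dichotomy (P5): local regularity of limits of `J`-curves,
modulo the named fact `Literature.Geometry.Symplectic.JHolomorphicWeierstrassR4`)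

**Local regularity of limits of entire `J`-curves.** Let `Σ` be a homotopy `4`-sphere, `p ∈ Σ`,
`J` an almost complex structure on `Σ ∖ p` (`J² = -1`, smooth frame expressions), `ι : Σ → ℝᴺ`
a `C^∞` injection, `h j : ℂ → Σ ∖ p` entire `J`-curves and `G : ℂ → Σ ∖ p` continuous with
`ι ∘ h j → ι ∘ G` uniformly on compact sets. Then, GIVEN the generalized Weierstraß theorem
`JHolomorphicWeierstrassR4` (Hummel 1997, III.3.1, flat `ℝ⁴` form), `G` is `C^∞` at every
`ζ₀`, `J`-holomorphic at `ζ₀`, and, if all `ι ∘ h j` have unit derivative at `ζ₀`, the chart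
expression of `G` at `ζ₀` has non-zero derivative.

Proof (chart localisation). Put `x₀ = G ζ₀`, `φ₀ = extChartAt (𝓡 4) x₀` (a chart of the open
submanifold `Σ ∖ p`, the restriction of the chart of `Σ` at `↑x₀`).
1. `helper_inTangentCoordinates_contMDiffOn` + `helper_chartJ` give the coordinate structure `Jc`
   on `φ₀.target` (smooth, `Jc² = -1`, `Jc ∘ φ₀ = Jin` = frame expression of `J`), and
   `helper_acsExtend` a global smooth `Jt` with `Jt² = -1` agreeing with `Jc` on an open
   `W ∋ φ₀ x₀`.
2. `O = φ₀.source ∩ φ₀ ⁻¹' W` is an open neighbourhood of `x₀`; choose `δ₀ > 0` with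
   `G (closedBall ζ₀ δ₀) ⊆ O`.
3. `helper_uniformLimit_localise` (through `ι`, on `D = closedBall ζ₀ δ₀`): `h j (D) ⊆ O` for
   `j ≥ j₀`, and `φ₀ ∘ h j → φ₀ ∘ G` uniformly on `D`.
4. On `U = ball ζ₀ δ₀` the chart expressions `w n = φ₀ ∘ h (n + j₀)` are `C^∞`
   (`contMDiffAt_extChartAt'`) and flat-`Jt`-holomorphic (`helper_jHolomorphic_chart`, as
   `Jt = Jc = Jin` along `O`), and converge locally uniformly to `wlim = φ₀ ∘ G`; the named fact
   yields: `wlim` is `C^∞` and flat-`Jt`-holomorphic on `U`, and `d(w n) → d wlim` locally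
   uniformly on `U`.
5. Back on the manifold: `helper_contMDiffAt_of_chart`, `helper_jHolomorphic_of_chart`
   (`Jt (wlim ζ₀) = Jin x₀`); for the derivative, `ι ∘ h j = Ψ ∘ (φ₀ ∘ h j)` near `ζ₀` with
   `Ψ = ι ∘ φ₀⁻¹` smooth on `φ₀.target`, so `1 = ‖d(ι ∘ h j)(ζ₀)‖ ≤ C ‖d(φ₀ ∘ h j)(ζ₀)‖` with
   `C` a local bound for `‖dΨ‖` near `φ₀ x₀`, and `‖d(φ₀ ∘ h j)(ζ₀)‖ → ‖d wlim (ζ₀)‖`, whence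
   `d wlim (ζ₀) ≠ 0`.
-/

noncomputable section

set_option linter.dupNamespace false

open scoped Manifold ContDiff Topology
open Set Filter Literature.Geometry.Kaehler Literature.Geometry.Symplectic
  Literature.Topology.FourManifolds

namespace Summit.SmoothPoincare4.SmoothPoincare4.Theorems.WitnessCharge.PencilIncompleteness

/-- **Local regularity of limits of entire `J`-curves, modulo `JHolomorphicWeierstrassR4`.**
For a homotopy `4`-sphere `Σ`, `p ∈ Σ`, an almost complex structure `J` on `Σ ∖ p` with smooth
frame expressions, a `C^∞` injection `ι : Σ → ℝᴺ`, entire `J`-curves `h j : ℂ → Σ ∖ p` and a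
continuous `G : ℂ → Σ ∖ p` with `ι ∘ h j → ι ∘ G` uniformly on compact sets: `G` is `C^∞` and
`J`-holomorphic at `ζ₀`, and if `‖d(ι ∘ h j)(ζ₀)‖ = 1` for all `j` then the chart expression of
`G` at `ζ₀` has non-zero derivative at `ζ₀`. (Chart localisation at `x₀ = G ζ₀`: the chart
expressions `φ₀ ∘ h j` are flat-holomorphic for a global extension `Jt` of the coordinate
structure and converge locally uniformly to `φ₀ ∘ G`; apply the named generalized Weierstraß
theorem and return to the manifold.) -/
theorem helper_rescaleLocal :
    JHolomorphicWeierstrassR4 →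
    ∀ (S : HomotopySphere 4) (p : S.carrier)
      (J : ∀ x : punctured p, TangentSpace (𝓡 4) x →L[ℝ] TangentSpace (𝓡 4) x),
      (∀ (x : punctured p) (v : TangentSpace (𝓡 4) x), J x (J x v) = -v) →
      (∀ x₀ : punctured p, ContMDiffAt (𝓡 4) 𝓘(ℝ, EuclideanSpace ℝ (Fin 4) →L[ℝ] EuclideanSpace ℝ (Fin 4)) ∞
        (inTangentCoordinates (𝓡 4) (𝓡 4) (id : punctured p → punctured p) id (fun x => J x) x₀) x₀) →
      ∀ (N : ℕ) (ι : S.carrier → EuclideanSpace ℝ (Fin N)),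
        ContMDiff (𝓡 4) 𝓘(ℝ, EuclideanSpace ℝ (Fin N)) ∞ ι → Function.Injective ι →
      ∀ (h : ℕ → ℂ → punctured p) (G : ℂ → punctured p) (ζ₀ : ℂ),
        (∀ j, IsEntireJCurve (𝓡 4) J (h j)) →
        Continuous G →
        (∀ D : Set ℂ, IsCompact D →
          TendstoUniformlyOn (fun j ζ => ι (h j ζ).1) (fun ζ => ι (G ζ).1) atTop D) →
        ContMDiffAt 𝓘(ℝ, ℂ) (𝓡 4) ∞ G ζ₀ ∧
        (∀ η : ℂ, mfderiv 𝓘(ℝ, ℂ) (𝓡 4) G ζ₀ (Complex.I * η : ℂ) =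
          J (G ζ₀) (mfderiv 𝓘(ℝ, ℂ) (𝓡 4) G ζ₀ (η : ℂ))) ∧
        ((∀ j, ‖fderiv ℝ (fun ζ : ℂ => ι (h j ζ).1) ζ₀‖ = 1) →
          fderiv ℝ (fun ζ : ℂ => extChartAt (𝓡 4) (G ζ₀) (G ζ)) ζ₀ ≠ 0) := by
  intro hW S p J hJ2 hJs N ι hι hιinj h G ζ₀ hh hG hunif
  set x₀ : punctured p := G ζ₀ with hx₀
  /- (1) chart localisation of `J` at `x₀` and a global extension `Jt` -/
  have hJon := helper_inTangentCoordinates_contMDiffOn (punctured p) J hJs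
  obtain ⟨Jc, hJc_smooth, hJc_sq, hJc_eq⟩ := helper_chartJ (punctured p) J hJ2 hJon x₀
  obtain ⟨Jt, W, hJt_smooth, hJt_sq, hW_open, hx₀W, -, hJtW⟩ :=
    helper_acsExtend Jc (extChartAt (𝓡 4) x₀).target (extChartAt (𝓡 4) x₀ x₀)
      (isOpen_extChartAt_target x₀) (mem_extChartAt_target x₀) hJc_smooth hJc_sq
  /- (2) the open neighbourhood `O` of `x₀` and the disc `D = closedBall ζ₀ δ₀` with `G '' D ⊆ O` -/
  set O : Set (punctured p) := (extChartAt (𝓡 4) x₀).source ∩ extChartAt (𝓡 4) x₀ ⁻¹' W with hO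
  have hO_open : IsOpen O :=
    (continuousOn_extChartAt x₀).isOpen_inter_preimage (isOpen_extChartAt_source x₀) hW_open
  have hx₀O : x₀ ∈ O := ⟨mem_extChartAt_source x₀, hx₀W⟩
  have hO_src : O ⊆ (chartAt (EuclideanSpace ℝ (Fin 4)) x₀).source := fun x hx => by
    rw [← extChartAt_source (𝓡 4)]
    exact hx.1
  have hO_src' : Subtype.val '' O ⊆ (extChartAt (𝓡 4) x₀.1).source := by
    rintro _ ⟨x, hx, rfl⟩
    have hx1 := hx.1
    rw [Literature.Geometry.Manifold.OpenSubmanifold.extChartAt_source_eq] at hx1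
    exact hx1
  obtain ⟨ε, hε, hεO⟩ : ∃ ε > 0, Metric.ball ζ₀ ε ⊆ G ⁻¹' O :=
    Metric.mem_nhds_iff.1 (hG.continuousAt.preimage_mem_nhds (hO_open.mem_nhds hx₀O))
  obtain ⟨δ₀, hδ₀, hδ₀ε⟩ : ∃ δ₀ : ℝ, 0 < δ₀ ∧ δ₀ < ε := ⟨ε / 2, half_pos hε, half_lt_self hε⟩
  set D : Set ℂ := Metric.closedBall ζ₀ δ₀ with hDdef
  have hD : IsCompact D := isCompact_closedBall ζ₀ δ₀
  have hDO : ∀ ζ ∈ D, G ζ ∈ O := fun ζ hζ => hεO (Metric.closedBall_subset_ball hδ₀ε hζ)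
  have hUD : Metric.ball ζ₀ δ₀ ⊆ D := Metric.ball_subset_closedBall
  have hζ₀U : ζ₀ ∈ Metric.ball ζ₀ δ₀ := Metric.mem_ball_self hδ₀
  /- (3) localisation of the uniform convergence through `ι` -/
  obtain ⟨hevO, hF⟩ := helper_uniformLimit_localise S.carrier N ι hι.continuous hιinj
    (fun j ζ => (h j ζ).1) (fun ζ => (G ζ).1) D hD (hunif D hD)
    ((continuous_subtype_val.comp hG).continuousOn) (Subtype.val '' O)
    ((punctured p).isOpenEmbedding'.isOpenMap O hO_open)
    (fun ζ hζ => mem_image_of_mem Subtype.val (hDO ζ hζ))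
  -- (3a) eventually `h j` maps `D` into `O`
  have hevO' : ∀ᶠ j in atTop, ∀ ζ ∈ D, h j ζ ∈ O := by
    filter_upwards [hevO] with j hj ζ hζ
    exact Subtype.val_injective.mem_set_image.1 (hj hζ)
  obtain ⟨j₀, hj₀⟩ := eventually_atTop.1 hevO'
  -- (3b) uniform convergence of the chart expressions on `D`
  have hunifφ : TendstoUniformlyOn (fun j ζ => extChartAt (𝓡 4) x₀ (h j ζ))
      (fun ζ => extChartAt (𝓡 4) x₀ (G ζ)) atTop D :=
    hF (extChartAt (𝓡 4) x₀.1) ((continuousOn_extChartAt x₀.1).mono hO_src')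
  /- (4) the named fact on `U = ball ζ₀ δ₀` for the shifted chart expressions -/
  -- smoothness of the chart expressions at the points of `D`, for `j ≥ j₀`
  have hsmooth : ∀ j, j₀ ≤ j → ∀ ζ ∈ D,
      ContDiffAt ℝ ∞ (fun ζ => extChartAt (𝓡 4) x₀ (h j ζ)) ζ := fun j hj ζ hζ =>
    contMDiffAt_iff_contDiffAt.1
      ((contMDiffAt_extChartAt' (hO_src (hj₀ j hj ζ hζ))).comp ζ ((hh j).contMDiff ζ))
  set w : ℕ → ℂ → EuclideanSpace ℝ (Fin 4) :=
    fun n ζ => extChartAt (𝓡 4) x₀ (h (n + j₀) ζ) with hw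
  set wlim : ℂ → EuclideanSpace ℝ (Fin 4) := fun ζ => extChartAt (𝓡 4) x₀ (G ζ) with hwlim
  have hw_smooth : ∀ n, ContDiffOn ℝ ∞ (w n) (Metric.ball ζ₀ δ₀) := fun n ζ hζ =>
    (hsmooth (n + j₀) (Nat.le_add_left j₀ n) ζ (hUD hζ)).contDiffWithinAt
  have hw_hol : ∀ n, ∀ z ∈ Metric.ball ζ₀ δ₀, ∀ ζ : ℂ,
      fderiv ℝ (w n) z (Complex.I * ζ) = Jt (w n z) (fderiv ℝ (w n) z ζ) := by
    intro n z hz ζ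
    have hzO : h (n + j₀) z ∈ O := hj₀ _ (Nat.le_add_left j₀ n) z (hUD hz)
    have hJ_eq : Jt (w n z) = inTangentCoordinates (𝓡 4) (𝓡 4) (id : punctured p → punctured p)
        id (fun x => J x) x₀ (h (n + j₀) z) := by
      rw [← hJc_eq _ (hO_src hzO)]
      exact hJtW _ hzO.2
    rw [hJ_eq]
    exact helper_jHolomorphic_chart (punctured p) J x₀ (h (n + j₀)) z ((hh _).contMDiff z)
      ((hh _).isJHolomorphic z) (hO_src hzO) ζ
  have hw_lim : TendstoLocallyUniformlyOn w wlim atTop (Metric.ball ζ₀ δ₀) := by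
    refine TendstoUniformlyOn.tendstoLocallyUniformlyOn ?_
    have h1 := hunifφ.mono hUD
    rw [Metric.tendstoUniformlyOn_iff] at h1 ⊢
    intro e he
    exact (tendsto_add_atTop_nat j₀).eventually (h1 e he)
  obtain ⟨hwlim_smooth, hwlim_hol, hwlim_d⟩ :=
    hW Jt hJt_smooth hJt_sq (Metric.ball ζ₀ δ₀) Metric.isOpen_ball w wlim hw_smooth hw_hol hw_lim
  /- (5) back to the manifold -/
  have hGsmooth : ContMDiffAt 𝓘(ℝ, ℂ) (𝓡 4) ∞ G ζ₀ :=
    helper_contMDiffAt_of_chart (punctured p) x₀ G ζ₀ hG.continuousAt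
      (mem_chart_source _ x₀) (hwlim_smooth.contDiffAt (Metric.isOpen_ball.mem_nhds hζ₀U))
  have hflat : ∀ η : ℂ, fderiv ℝ (fun w : ℂ => extChartAt (𝓡 4) x₀ (G w)) ζ₀ (Complex.I * η) =
      inTangentCoordinates (𝓡 4) (𝓡 4) (id : punctured p → punctured p) id (fun x => J x) x₀ x₀
        (fderiv ℝ (fun w : ℂ => extChartAt (𝓡 4) x₀ (G w)) ζ₀ η) := by
    intro η
    have e2 : Jt (wlim ζ₀) = inTangentCoordinates (𝓡 4) (𝓡 4) (id : punctured p → punctured p)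
        id (fun x => J x) x₀ x₀ := by
      rw [← hJc_eq x₀ (mem_chart_source _ x₀)]
      exact hJtW _ hx₀W
    rw [← e2]
    exact hwlim_hol ζ₀ hζ₀U η
  have hGhol : ∀ η : ℂ, mfderiv 𝓘(ℝ, ℂ) (𝓡 4) G ζ₀ (Complex.I * η : ℂ) =
      J x₀ (mfderiv 𝓘(ℝ, ℂ) (𝓡 4) G ζ₀ (η : ℂ)) :=
    helper_jHolomorphic_of_chart (punctured p) J x₀ G ζ₀ hGsmooth (mem_chart_source _ x₀) hflat
  refine ⟨hGsmooth, hGhol, fun hnorm => ?_⟩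
  /- immersivity at `ζ₀` under the normalisation `‖d(ι ∘ h j)(ζ₀)‖ = 1` -/
  -- `Ψ = ι ∘ φ₀⁻¹`, smooth on the open chart target
  set Ψ : EuclideanSpace ℝ (Fin 4) → EuclideanSpace ℝ (Fin N) :=
    fun y => ι ((extChartAt (𝓡 4) x₀).symm y).1 with hΨ
  have hΨ_smooth : ContDiffOn ℝ ∞ Ψ (extChartAt (𝓡 4) x₀).target := by
    have h1 : ContMDiff (𝓡 4) 𝓘(ℝ, EuclideanSpace ℝ (Fin N)) ∞ (fun x : punctured p => ι x.1) :=
      hι.comp contMDiff_subtype_val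
    exact contMDiffOn_iff_contDiffOn.1 (h1.comp_contMDiffOn (contMDiffOn_extChartAt_symm x₀))
  have hΨ_cont : ContinuousOn (fderiv ℝ Ψ) (extChartAt (𝓡 4) x₀).target :=
    hΨ_smooth.continuousOn_fderiv_of_isOpen (isOpen_extChartAt_target x₀) (by simp)
  set y₀ : EuclideanSpace ℝ (Fin 4) := extChartAt (𝓡 4) x₀ x₀ with hy₀
  have htarget_nhds : (extChartAt (𝓡 4) x₀).target ∈ 𝓝 y₀ :=
    (isOpen_extChartAt_target x₀).mem_nhds (mem_extChartAt_target x₀)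
  set C : ℝ := ‖fderiv ℝ Ψ y₀‖ + 1 with hC
  have hev_bound : ∀ᶠ y in 𝓝 y₀, ‖fderiv ℝ Ψ y‖ < C :=
    ((hΨ_cont.continuousAt htarget_nhds).norm).eventually_lt tendsto_const_nhds (lt_add_one _)
  have hev_diff : ∀ᶠ y in 𝓝 y₀, DifferentiableAt ℝ Ψ y := by
    filter_upwards [htarget_nhds] with y hy
    exact (hΨ_smooth.differentiableOn (by simp)).differentiableAt
      ((isOpen_extChartAt_target x₀).mem_nhds hy)
  -- the chart points `φ₀ (h j ζ₀)` converge to `y₀`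
  have hpt : Tendsto (fun j => extChartAt (𝓡 4) x₀ (h j ζ₀)) atTop (𝓝 y₀) :=
    hunifφ.tendsto_at (hUD hζ₀U)
  have hev1 : ∀ᶠ j in atTop, ‖fderiv ℝ Ψ (extChartAt (𝓡 4) x₀ (h j ζ₀))‖ < C ∧
      DifferentiableAt ℝ Ψ (extChartAt (𝓡 4) x₀ (h j ζ₀)) :=
    hpt.eventually (hev_bound.and hev_diff)
  -- chain rule: `1 = ‖d(ι ∘ h j)(ζ₀)‖ ≤ C * ‖d(φ₀ ∘ h j)(ζ₀)‖` for large `j`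
  have hev3 : ∀ᶠ j in atTop,
      (1 : ℝ) ≤ C * ‖fderiv ℝ (fun ζ => extChartAt (𝓡 4) x₀ (h j ζ)) ζ₀‖ := by
    filter_upwards [hev1, eventually_ge_atTop j₀] with j hj1 hj2
    have heq : (fun ζ : ℂ => ι (h j ζ).1) =ᶠ[𝓝 ζ₀]
        (Ψ ∘ fun ζ => extChartAt (𝓡 4) x₀ (h j ζ)) := by
      filter_upwards [Metric.closedBall_mem_nhds ζ₀ hδ₀] with ζ hζ
      have hζO : h j ζ ∈ O := hj₀ j hj2 ζ hζ
      show ι (h j ζ).1 = ι ((extChartAt (𝓡 4) x₀).symm (extChartAt (𝓡 4) x₀ (h j ζ))).1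
      rw [(extChartAt (𝓡 4) x₀).left_inv hζO.1]
    have hdiff_in : DifferentiableAt ℝ (fun ζ => extChartAt (𝓡 4) x₀ (h j ζ)) ζ₀ :=
      (hsmooth j hj2 ζ₀ (hUD hζ₀U)).differentiableAt (by simp)
    have hcomp : fderiv ℝ (fun ζ : ℂ => ι (h j ζ).1) ζ₀ =
        (fderiv ℝ Ψ (extChartAt (𝓡 4) x₀ (h j ζ₀))).comp
          (fderiv ℝ (fun ζ => extChartAt (𝓡 4) x₀ (h j ζ)) ζ₀) := by
      rw [heq.fderiv_eq]
      exact fderiv_comp ζ₀ (f := fun ζ => extChartAt (𝓡 4) x₀ (h j ζ)) hj1.2 hdiff_in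
    rw [← hnorm j, hcomp]
    exact (ContinuousLinearMap.opNorm_comp_le _ _).trans (by gcongr; exact hj1.1.le)
  -- pass to the limit along `n ↦ n + j₀`
  have hev4 : ∀ᶠ n in atTop, (1 : ℝ) ≤ C * ‖fderiv ℝ (w n) ζ₀‖ :=
    (tendsto_add_atTop_nat j₀).eventually hev3
  have hlimd : Tendsto (fun n => C * ‖fderiv ℝ (w n) ζ₀‖) atTop (𝓝 (C * ‖fderiv ℝ wlim ζ₀‖)) :=
    ((hwlim_d.tendsto_at hζ₀U).norm).const_mul C
  have hge : (1 : ℝ) ≤ C * ‖fderiv ℝ wlim ζ₀‖ := ge_of_tendsto hlimd hev4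
  have hne : fderiv ℝ wlim ζ₀ ≠ 0 := by
    intro hzero
    rw [hzero, norm_zero, mul_zero] at hge
    exact absurd hge (by norm_num)
  exact hne

end Summit.SmoothPoincare4.SmoothPoincare4.Theorems.WitnessCharge.PencilIncompleteness
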